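import Mathlib
import Summits.Ventures.HodgeRepro2.LevelPositivity
import Summits.Ventures.HodgeRepro2.T5DixmierSchur

/-!
# Schur's lemma for smooth admissible representations (the countable-dimension feeders)

Blind cell `pub-hodge-repro2`, seat p8 (gen 5), Tier-5 kernel support.  `T5DixmierSchur`
proves Dixmier's lemma: a simple module of countable dimension over an uncountable algebraically
closed field has only scalar endomorphisms.  This file supplies the two feeders that the record
(route/T5-N3-route-2.md §N3.10.3 / §N3.12.4; route/T5-CHECK-N3-p8.md v5 §§7, 9) uses in prose
when it invokes «Schur's lemma for the irreducible ρ»: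

1. COUNTABLE DIMENSION.  A countable family of submodules of countable rank whose supremum is
   the whole space gives countable rank (`rank_le_aleph0_of_iSup_eq_top`).  For a smooth
   representation `ρ` (every stabiliser open, `LevelPositivity.IsSmooth`) and a countable family
   of open subgroups `K i` forming a basis (every open subgroup contains some `K i`), the
   `K i`-invariants exhaust `V` (`iSup_invariants_eq_top`); if moreover each `V^{K i}` is
   finite-dimensional (admissibility) then `rank_k V ≤ ℵ₀`
   (`rank_le_aleph0_of_finiteDimensional_invariants`).
2. EQUIVARIANT = `k[G]`-LINEAR.  A `G`-equivariant `k`-linear endomorphism of `V` is a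
   `k[G]`-linear endomorphism of `ρ.asModule` (`toAsModuleEnd`), so Dixmier applies to the
   `k[G]`-module `ρ.asModule` when `ρ` is irreducible (`IsSimpleModule k[G] ρ.asModule`).

MAIN: `exists_smul_eq_of_equivariant` — over an uncountable algebraically closed `k`, an
irreducible representation of countable dimension has only scalar equivariant endomorphisms;
`exists_smul_eq_of_smooth_admissible` — the same for an irreducible smooth representation with
finite-dimensional invariants along a countable basis of open subgroups; `…_complex` instances.

3. CENTRAL CHARACTER.  Central elements act by scalars (`exists_smul_eq_of_mem_center`), and
   the scalars form a monoid homomorphism `Z(G) →* k` (`centralCharacter`) with non-zero values —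
   the hypothesis «`z` acts by the scalar `χ(z)`» of `LevelInvariantsCount.central_character_eq_one`.

The archimedean side of the record ((𝔤,K)-modules) uses the same feeder in the form
`rank_le_aleph0_of_iSup_eq_top_of_finite`: an admissible `(𝔤,K)`-module is the sum of its
countably many finite-dimensional `K`-isotypic pieces (countability of the unitary dual of a
compact Lie group — prose).

What stays prose: that the p-adic groups of the record have a countable basis of open compact
subgroups (second countability), and that the representations of the record are smooth,
admissible and irreducible — these are the hypotheses of the theorems below.

README §8(d): uses an L-value-free non-vanishing device: NO (pure algebra / point-set topology).
-/

namespace Summit.Ventures.HodgeRepro2.T5SchurRepresentation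

open Cardinal
open Summit.Ventures.HodgeRepro2.LevelPositivity
open Summit.Ventures.HodgeRepro2.T5DixmierSchur

section CountableUnion

variable {k M : Type*} [Field k] [AddCommGroup M] [Module k M]

/-- Each submodule `V i` is spanned by the values in `M` of a chosen basis. -/
theorem le_span_range_subtype_comp_basis (V : Submodule k M) {ι : Type*}
    (b : Module.Basis ι k V) : V ≤ Submodule.span k (Set.range (V.subtype ∘ b)) := by
  rw [Set.range_comp, ← Submodule.map_span, b.span_eq, Submodule.map_subtype_top]

/-- **Countable union.** A countable family of submodules, each of countable rank, whose
supremum is the whole module, forces the module to have countable rank. -/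
theorem rank_le_aleph0_of_iSup_eq_top {ι : Type*} [Countable ι] (V : ι → Submodule k M)
    (hV : ∀ i, Module.rank k (V i) ≤ ℵ₀) (htop : ⨆ i, V i = ⊤) : Module.rank k M ≤ ℵ₀ := by
  classical
  let b : ∀ i, Module.Basis (Module.Free.ChooseBasisIndex k (V i)) k (V i) :=
    fun i => Module.Free.chooseBasis k (V i)
  have hc : ∀ i, Countable (Module.Free.ChooseBasisIndex k (V i)) := fun i =>
    Cardinal.mk_le_aleph0_iff.mp
      ((Module.Free.rank_eq_card_chooseBasisIndex k (V i)).symm.le.trans (hV i))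
  have hs : (⋃ i, Set.range ((V i).subtype ∘ b i)).Countable :=
    Set.countable_iUnion fun i => Set.countable_range _
  have hspan : Submodule.span k (⋃ i, Set.range ((V i).subtype ∘ b i)) = ⊤ := by
    rw [eq_top_iff, ← htop]
    exact iSup_le fun i =>
      (le_span_range_subtype_comp_basis (V i) (b i)).trans
        (Submodule.span_mono (Set.subset_iUnion (fun i => Set.range ((V i).subtype ∘ b i)) i))
  exact rank_le_aleph0_of_countable_span hs hspan

/-- A countable family of finite-dimensional submodules with supremum `⊤` gives countable
rank. -/
theorem rank_le_aleph0_of_iSup_eq_top_of_finite {ι : Type*} [Countable ι]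
    (V : ι → Submodule k M) [∀ i, FiniteDimensional k (V i)] (htop : ⨆ i, V i = ⊤) :
    Module.rank k M ≤ ℵ₀ :=
  rank_le_aleph0_of_iSup_eq_top V (fun i => (Module.rank_lt_aleph0 k (V i)).le) htop

end CountableUnion

section Smooth

variable {G : Type*} [Group G] [TopologicalSpace G] {k V : Type*} [Field k] [AddCommGroup V]
  [Module k V]

/-- For a smooth representation and a family of subgroups `K i` that is a basis of the open
subgroups (every open subgroup contains some `K i`), the `K i`-invariants exhaust `V`:
`V = ⋃_i V^{K i}`. -/
theorem iSup_invariants_eq_top (ρ : Representation k G V) (hρ : IsSmooth ρ) {ι : Type*}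
    (K : ι → Subgroup G) (hbasis : ∀ U : Subgroup G, IsOpen (U : Set G) → ∃ i, K i ≤ U) :
    ⨆ i, invariants ρ (K i) = ⊤ := by
  rw [eq_top_iff]
  intro v _
  obtain ⟨i, hi⟩ := hbasis (stabilizer ρ v) (hρ v)
  refine Submodule.mem_iSup_of_mem i ?_
  rw [mem_invariants_iff]
  intro g hg
  exact mem_stabilizer_iff.mp (hi hg)

/-- A smooth representation whose invariants along a countable basis of open subgroups have
countable rank has countable rank. -/
theorem rank_le_aleph0_of_smooth (ρ : Representation k G V) (hρ : IsSmooth ρ) {ι : Type*}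
    [Countable ι] (K : ι → Subgroup G)
    (hbasis : ∀ U : Subgroup G, IsOpen (U : Set G) → ∃ i, K i ≤ U)
    (hadm : ∀ i, Module.rank k (invariants ρ (K i)) ≤ ℵ₀) : Module.rank k V ≤ ℵ₀ :=
  rank_le_aleph0_of_iSup_eq_top (fun i => invariants ρ (K i)) hadm
    (iSup_invariants_eq_top ρ hρ K hbasis)

/-- **Admissible ⇒ countable dimension.** A smooth representation with finite-dimensional
invariants along a countable basis of open subgroups has countable rank. -/
theorem rank_le_aleph0_of_finiteDimensional_invariants (ρ : Representation k G V)
    (hρ : IsSmooth ρ) {ι : Type*} [Countable ι] (K : ι → Subgroup G)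
    (hbasis : ∀ U : Subgroup G, IsOpen (U : Set G) → ∃ i, K i ≤ U)
    [∀ i, FiniteDimensional k (invariants ρ (K i))] : Module.rank k V ≤ ℵ₀ :=
  rank_le_aleph0_of_smooth ρ hρ K hbasis fun i =>
    (Module.rank_lt_aleph0 k (invariants ρ (K i))).le

end Smooth

section Equivariant

variable {G : Type*} [Group G] {k V : Type*} [Field k] [AddCommGroup V] [Module k V]
  (ρ : Representation k G V)

/-- A `G`-equivariant `k`-linear endomorphism `f` of `V` commutes with the action of every element
of the group algebra. -/
theorem asAlgebraHom_comm (f : V →ₗ[k] V) (hf : ∀ g v, f (ρ g v) = ρ g (f v))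
    (r : MonoidAlgebra k G) (v : V) : f (ρ.asAlgebraHom r v) = ρ.asAlgebraHom r (f v) := by
  induction r using MonoidAlgebra.induction_on with
  | hM g => rw [Representation.asAlgebraHom_of]; exact hf g v
  | hadd x y hx hy => rw [map_add, LinearMap.add_apply, map_add, hx, hy, LinearMap.add_apply]
  | hsmul t x hx => rw [map_smul, LinearMap.smul_apply, map_smul, hx, LinearMap.smul_apply]

/-- A `G`-equivariant `k`-linear endomorphism of `V`, as a `k[G]`-linear endomorphism of
`ρ.asModule`. -/
def toAsModuleEnd (f : V →ₗ[k] V) (hf : ∀ g v, f (ρ g v) = ρ g (f v)) :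
    ρ.asModule →ₗ[MonoidAlgebra k G] ρ.asModule where
  toFun x := ρ.asModuleEquiv.symm (f (ρ.asModuleEquiv x))
  map_add' x y := by rw [map_add, map_add, map_add]
  map_smul' r x := by
    rw [RingHom.id_apply, Representation.asModuleEquiv_map_smul, asAlgebraHom_comm ρ f hf,
      LinearEquiv.symm_apply_eq, Representation.asModuleEquiv_map_smul,
      LinearEquiv.apply_symm_apply]

/-- `toAsModuleEnd ρ f hf x = f x` on underlying vectors. -/
theorem toAsModuleEnd_apply (f : V →ₗ[k] V) (hf : ∀ g v, f (ρ g v) = ρ g (f v))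
    (x : ρ.asModule) :
    ρ.asModuleEquiv (toAsModuleEnd ρ f hf x) = f (ρ.asModuleEquiv x) :=
  LinearEquiv.apply_symm_apply _ _

/-- **Schur's lemma for representations (Dixmier form).** Over an uncountable algebraically
closed field `k`, every `G`-equivariant endomorphism of an irreducible representation of countable
dimension is a scalar. -/
theorem exists_smul_eq_of_equivariant [IsAlgClosed k] (hk : ℵ₀ < #k)
    [IsSimpleModule (MonoidAlgebra k G) ρ.asModule] (hV : Module.rank k V ≤ ℵ₀)
    (f : V →ₗ[k] V) (hf : ∀ g v, f (ρ g v) = ρ g (f v)) : ∃ c : k, ∀ v, f v = c • v := by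
  have hM : Module.rank k ρ.asModule ≤ ℵ₀ := by
    rw [ρ.asModuleEquiv.rank_eq]
    exact hV
  obtain ⟨c, hc⟩ := exists_smul_eq hk hM (toAsModuleEnd ρ f hf)
  refine ⟨c, fun v => ?_⟩
  have h := congrArg ρ.asModuleEquiv (hc (ρ.asModuleEquiv.symm v))
  rw [toAsModuleEnd_apply ρ f hf, LinearEquiv.apply_symm_apply, map_smul,
    LinearEquiv.apply_symm_apply] at h
  exact h

/-- **Schur for smooth admissible irreducible representations.** If `ρ` is smooth, irreducible,
and has finite-dimensional invariants along a countable basis of open subgroups, then over an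
uncountable algebraically closed field every equivariant endomorphism is a scalar. -/
theorem exists_smul_eq_of_smooth_admissible [TopologicalSpace G] [IsAlgClosed k] (hk : ℵ₀ < #k)
    [IsSimpleModule (MonoidAlgebra k G) ρ.asModule] (hρ : IsSmooth ρ) {ι : Type*} [Countable ι]
    (K : ι → Subgroup G) (hbasis : ∀ U : Subgroup G, IsOpen (U : Set G) → ∃ i, K i ≤ U)
    [∀ i, FiniteDimensional k (invariants ρ (K i))] (f : V →ₗ[k] V)
    (hf : ∀ g v, f (ρ g v) = ρ g (f v)) : ∃ c : k, ∀ v, f v = c • v :=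
  exists_smul_eq_of_equivariant ρ hk
    (rank_le_aleph0_of_finiteDimensional_invariants ρ hρ K hbasis) f hf

/-- A non-zero vector exists in an irreducible representation. -/
theorem exists_ne_zero [IsSimpleModule (MonoidAlgebra k G) ρ.asModule] : ∃ v : V, v ≠ 0 := by
  have := IsSimpleModule.nontrivial (MonoidAlgebra k G) ρ.asModule
  obtain ⟨x, hx⟩ := exists_ne (0 : ρ.asModule)
  exact ⟨ρ.asModuleEquiv x, (LinearEquiv.map_ne_zero_iff _).mpr hx⟩

/-- The action of a central element is `G`-equivariant. -/
theorem apply_comm_of_mem_center {z : G} (hz : z ∈ Subgroup.center G) (g : G) (v : V) :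
    ρ z (ρ g v) = ρ g (ρ z v) := by
  rw [← Module.End.mul_apply, ← Module.End.mul_apply, ← map_mul, ← map_mul,
    (Subgroup.mem_center_iff.mp hz g)]

end Equivariant

section CentralCharacter

variable {G : Type*} [Group G] {k V : Type*} [Field k] [AddCommGroup V] [Module k V]
  (ρ : Representation k G V) [IsAlgClosed k] [IsSimpleModule (MonoidAlgebra k G) ρ.asModule]

/-- **Central character, pointwise.** In an irreducible representation of countable dimension
over an uncountable algebraically closed field, every central element acts by a scalar. -/
theorem exists_smul_eq_of_mem_center (hk : ℵ₀ < #k) (hV : Module.rank k V ≤ ℵ₀) {z : G}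
    (hz : z ∈ Subgroup.center G) : ∃ c : k, ∀ v, ρ z v = c • v :=
  exists_smul_eq_of_equivariant ρ hk hV (ρ z) (apply_comm_of_mem_center ρ hz)

/-- The scalar by which the central element `z` acts (a choice; unique since `V ≠ 0`). -/
noncomputable def centralScalar (hk : ℵ₀ < #k) (hV : Module.rank k V ≤ ℵ₀)
    (z : Subgroup.center G) : k :=
  Classical.choose (exists_smul_eq_of_mem_center ρ hk hV z.2)

/-- `ρ z v = centralScalar z • v` for `z` central. -/
theorem centralScalar_spec (hk : ℵ₀ < #k) (hV : Module.rank k V ≤ ℵ₀) (z : Subgroup.center G)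
    (v : V) : ρ z v = centralScalar ρ hk hV z • v :=
  Classical.choose_spec (exists_smul_eq_of_mem_center ρ hk hV z.2) v

/-- The central scalar is multiplicative. -/
theorem centralScalar_mul (hk : ℵ₀ < #k) (hV : Module.rank k V ≤ ℵ₀) (z z' : Subgroup.center G) :
    centralScalar ρ hk hV (z * z') = centralScalar ρ hk hV z * centralScalar ρ hk hV z' := by
  obtain ⟨v, hv⟩ := exists_ne_zero ρ
  have h1 : ρ (z * z' : Subgroup.center G) v =
      (centralScalar ρ hk hV z * centralScalar ρ hk hV z') • v := by
    rw [Subgroup.coe_mul, map_mul, Module.End.mul_apply, centralScalar_spec ρ hk hV z',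
      map_smul, centralScalar_spec ρ hk hV z, smul_smul, mul_comm]
  rw [centralScalar_spec ρ hk hV (z * z') v] at h1
  exact smul_left_injective k hv h1

/-- The central scalar of `1` is `1`. -/
theorem centralScalar_one (hk : ℵ₀ < #k) (hV : Module.rank k V ≤ ℵ₀) :
    centralScalar ρ hk hV 1 = 1 := by
  obtain ⟨v, hv⟩ := exists_ne_zero ρ
  have h1 := centralScalar_spec ρ hk hV 1 v
  rw [Subgroup.coe_one, map_one, Module.End.one_apply] at h1
  exact (smul_left_injective k hv (h1.symm.trans (one_smul k v).symm))

/-- **The central character** `Z(G) →* k` of an irreducible representation of countable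
dimension over an uncountable algebraically closed field: the scalar by which each central element
acts.  (This is the hypothesis «`z` acts by the scalar `χ(z)`» of
`LevelInvariantsCount.central_character_eq_one`, now supplied by Schur.) -/
noncomputable def centralCharacter (hk : ℵ₀ < #k) (hV : Module.rank k V ≤ ℵ₀) :
    Subgroup.center G →* k where
  toFun := centralScalar ρ hk hV
  map_one' := centralScalar_one ρ hk hV
  map_mul' := centralScalar_mul ρ hk hV

/-- `ρ z v = centralCharacter z • v`. -/
theorem centralCharacter_spec (hk : ℵ₀ < #k) (hV : Module.rank k V ≤ ℵ₀)
    (z : Subgroup.center G) (v : V) : ρ z v = centralCharacter ρ hk hV z • v :=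
  centralScalar_spec ρ hk hV z v

/-- The central character takes non-zero values. -/
theorem centralCharacter_ne_zero (hk : ℵ₀ < #k) (hV : Module.rank k V ≤ ℵ₀)
    (z : Subgroup.center G) : centralCharacter ρ hk hV z ≠ 0 := by
  intro h0
  obtain ⟨v, hv⟩ := exists_ne_zero ρ
  have h1 : ρ z v = 0 := by rw [centralCharacter_spec ρ hk hV z v, h0, zero_smul]
  have h2 : v = ρ (z⁻¹ : Subgroup.center G) (ρ z v) := by
    rw [← Module.End.mul_apply, ← map_mul, Subgroup.coe_inv, inv_mul_cancel, map_one,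
      Module.End.one_apply]
  rw [h1, map_zero] at h2
  exact hv h2

end CentralCharacter

section Complex

variable {G : Type*} [Group G] {V : Type*} [AddCommGroup V] [Module ℂ V]
  (ρ : Representation ℂ G V)

/-- Schur over `ℂ` for an irreducible representation of countable dimension. -/
theorem exists_smul_eq_of_equivariant_complex [IsSimpleModule (MonoidAlgebra ℂ G) ρ.asModule]
    (hV : Module.rank ℂ V ≤ ℵ₀) (f : V →ₗ[ℂ] V) (hf : ∀ g v, f (ρ g v) = ρ g (f v)) :
    ∃ c : ℂ, ∀ v, f v = c • v :=
  exists_smul_eq_of_equivariant ρ aleph0_lt_mk_complex hV f hf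

/-- Schur over `ℂ` for an irreducible smooth representation with finite-dimensional invariants
along a countable basis of open subgroups. -/
theorem exists_smul_eq_of_smooth_admissible_complex [TopologicalSpace G]
    [IsSimpleModule (MonoidAlgebra ℂ G) ρ.asModule] (hρ : IsSmooth ρ) {ι : Type*} [Countable ι]
    (K : ι → Subgroup G) (hbasis : ∀ U : Subgroup G, IsOpen (U : Set G) → ∃ i, K i ≤ U)
    [∀ i, FiniteDimensional ℂ (invariants ρ (K i))] (f : V →ₗ[ℂ] V)
    (hf : ∀ g v, f (ρ g v) = ρ g (f v)) : ∃ c : ℂ, ∀ v, f v = c • v :=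
  exists_smul_eq_of_smooth_admissible ρ aleph0_lt_mk_complex hρ K hbasis f hf

end Complex

end Summit.Ventures.HodgeRepro2.T5SchurRepresentation
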